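import Mathlib
import Literature.AlgebraicGeometry.Resolution.RegularParameterQuotient
import Literature.RingTheory.KrullDimension.AffineDimension
import Summits.ResolutionOfSingularities.ResolutionOfSingularities.Theorems.PAlterationPicoverLocalModelWoundExit
import Summits.ResolutionOfSingularities.ResolutionOfSingularities.Theorems.PAlterationPicoverLocalModelTransversalExit

/-!
# Crux `PicoverLocalModel` (stmt-ResolutionOfSingularities-0557), line `SketchIdeator3`
# (giraud-cossart-normal-form) — endgame, local charts: the boundary equations stay regular
# parameters of the wound twist

Helpers of the stub `stub_localCharts`. At a wound/transversal point `w'` of the regular base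
(`a = g^p + (∏ x_j^{B_j})^p · u`, `u` wound-or-transversal relative to the boundary equations
`x_j`, `IsWoundOrTransversalAt`), the local ring of the normalised cover is the wound twist
`C = 𝒪[T]/(T^p - u)` (`WoundTwistIntegralClosure`, landed), a regular local ring by the two
exits (`WoundExit`, `TransversalExit`, landed). The free chart `ℕ^J → C`, `e_j ↦ x_j`, is log
regular at the closed point iff `C/(x_j)_{j}` is regular of dimension `dim C - #J` (Kato 1994,
Def. (2.1)); this file proves exactly that:

* `isRegularLocalRing_woundTwist` — `C` is a regular local ring (the two exits, combined under
  `IsWoundOrTransversalAt`);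
* `ringKrullDim_woundTwist` — `dim C = dim 𝒪` (`C` is finite free over `𝒪`);
* `isRegularLocalRing_woundTwist_quotient_parameters` — `C/(x_1, …, x_r) C` is a regular
  local ring with `dim C/(x)C + r = dim C`: modulo the boundary, `C/(x)C = (𝒪/(x))[T]/(T^p - ū)`
  is the wound twist of the regular local ring `𝒪/(x)` (Matsumura 14.2,
  `isRegularLocalRing_quotient_span_range`) at the boundary-free wound-or-transversal unit `ū`
  (`isWoundOrTransversalAt_quotient`), regular by the exits.
-/

noncomputable section

-- single-problem summit: the doubled namespace component `ResolutionOfSingularities` is the tree layout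
set_option linter.dupNamespace false

open IsLocalRing Polynomial Literature.AlgebraicGeometry.Resolution

namespace Summit.ResolutionOfSingularities.ResolutionOfSingularities.Theorems.PicoverLocalModel.LocalCharts

/-- **The wound twist at a wound/transversal point is a regular local ring**: for a regular local
ring `𝒪` of characteristic `p` and `u` wound-or-transversal relative to boundary equations in
`𝔪` (`IsWoundOrTransversalAt`), `𝒪[T]/(T^p - u)` is regular local (wound exit, resp.
transversal exit with `u - c^p ∈ 𝔪 ∖ 𝔪²`). [cite: Giraud1983, Prop. 1.5] -/
theorem isRegularLocalRing_woundTwist : ∀ {O : Type*} [CommRing O] [IsRegularLocalRing O] (p : ℕ) [Fact p.Prime] [CharP O p] {r : ℕ} (x : Fin r → O) (u : O), IsWoundOrTransversalAt p x u → IsRegularLocalRing (AdjoinRoot ((Polynomial.X : Polynomial O) ^ p - Polynomial.C u)) := by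
  intro O _ _ p _ _ r x u hu
  rcases hu with hw | ⟨c, hc, hc2⟩
  · exact WoundExit.isRegularLocalRing_adjoinRoot_of_wound p Fact.out u hw
  · exact TransversalExit.isRegularLocalRing_adjoinRoot_of_transversal p u c hc
      (fun h => hc2 (Ideal.mem_sup_left h))

/-- **The wound twist has the dimension of the base**: `dim 𝒪[T]/(T^p - u) = dim 𝒪` (a finite
free, hence integral and faithful, extension; `0 < p`). [folklore] -/
theorem ringKrullDim_woundTwist : ∀ {O : Type*} [CommRing O] [Nontrivial O] (p : ℕ), 0 < p → ∀ (u : O), ringKrullDim (AdjoinRoot ((Polynomial.X : Polynomial O) ^ p - Polynomial.C u)) = ringKrullDim O := by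
  intro O _ _ p hp u
  have hmonic : ((X : O[X]) ^ p - C u).Monic := monic_X_pow_sub_C u hp.ne'
  haveI := hmonic.finite_adjoinRoot
  haveI : Algebra.IsIntegral O (AdjoinRoot ((X : O[X]) ^ p - C u)) := inferInstance
  have hdeg : ((X : O[X]) ^ p - C u).natDegree = p := natDegree_X_pow_sub_C
  have hinj : Function.Injective (algebraMap O (AdjoinRoot ((X : O[X]) ^ p - C u))) := by
    intro a b hab
    rw [← sub_eq_zero, ← map_sub] at hab
    by_contra hne
    have hne' : a - b ≠ 0 := sub_ne_zero.mpr hne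
    change AdjoinRoot.mk _ (C (a - b)) = 0 at hab
    rw [AdjoinRoot.mk_eq_zero] at hab
    refine hmonic.not_dvd_of_natDegree_lt (C_ne_zero.mpr hne') ?_ hab
    rw [natDegree_C, hdeg]
    exact hp
  exact (Literature.RingTheory.KrullDimension.ringKrullDim_eq_of_isIntegral hinj).symm

/-- A proper quotient of a ring of prime characteristic `p` has characteristic `p` (an
integer prime to `p` is a unit). [folklore] -/
theorem charP_quotient_of_ne_top {R : Type*} [CommRing R] (p : ℕ) [Fact p.Prime] [CharP R p]
    (I : Ideal R) (hI : I ≠ ⊤) : CharP (R ⧸ I) p := by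
  refine CharP.quotient' p I fun n hn => ?_
  by_contra hne
  have hcop : (p : ℕ).Coprime n := by
    refine (Nat.Prime.coprime_iff_not_dvd Fact.out).mpr fun hdvd => hne ?_
    exact (CharP.cast_eq_zero_iff R p n).mpr hdvd
  have hunit : IsUnit (ZMod.castHom (dvd_refl p) R (n : ZMod p)) := by
    have := (ZMod.unitOfCoprime n hcop.symm).isUnit
    rw [ZMod.coe_unitOfCoprime] at this
    exact this.map (ZMod.castHom (dvd_refl p) R)
  rw [map_natCast] at hunit
  exact hI (Ideal.eq_top_of_isUnit_mem I hn hunit)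

/-- **The boundary equations stay regular parameters of the wound twist.** For a regular local
ring `𝒪` of characteristic `p`, boundary equations `x_1, …, x_r ∈ 𝔪` independent modulo `𝔪²`,
and `u` wound-or-transversal relative to them, the wound twist `C = 𝒪[T]/(T^p - u)` satisfies:
`C/(x_1, …, x_r)C` is a regular local ring and `dim C/(x)C + r = dim C` — i.e. Kato's condition
(2.1) for the free chart `ℕʳ → C`, `e_j ↦ x_j`, at the closed point. Proof:
`C/(x)C ≅ (𝒪/(x))[T]/(T^p - ū)` (`AdjoinRoot.quotEquivQuotMap`), `𝒪/(x)` is regular of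
dimension `dim 𝒪 - r` (Matsumura 14.2) and `ū` is wound-or-transversal there, so the exits
apply; `dim C = dim 𝒪`. [cite: Kato1994, Def. (2.1)] -/
theorem isRegularLocalRing_woundTwist_quotient_parameters : ∀ {O : Type*} [CommRing O] [IsRegularLocalRing O] (p : ℕ) [Fact p.Prime] [CharP O p] {r : ℕ} (x : Fin r → O), (∀ j, x j ∈ IsLocalRing.maximalIdeal O) → (∀ α : Fin r → O, ∑ i, α i * x i ∈ IsLocalRing.maximalIdeal O ^ 2 → ∀ i, α i ∈ IsLocalRing.maximalIdeal O) → ∀ (u : O), IsWoundOrTransversalAt p x u → IsRegularLocalRing (AdjoinRoot ((Polynomial.X : Polynomial O) ^ p - Polynomial.C u) ⧸ (Ideal.span (Set.range x)).map (AdjoinRoot.of ((Polynomial.X : Polynomial O) ^ p - Polynomial.C u))) ∧ ringKrullDim (AdjoinRoot ((Polynomial.X : Polynomial O) ^ p - Polynomial.C u) ⧸ (Ideal.span (Set.range x)).map (AdjoinRoot.of ((Polynomial.X : Polynomial O) ^ p - Polynomial.C u))) + r = ringKrullDim (AdjoinRoot ((Polynomial.X : Polynomial O) ^ p - Polynomial.C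 u)) := by
  intro O _ _ p _ _ r x hx hli u hu
  have hp : p.Prime := Fact.out
  set f : O[X] := X ^ p - C u with hf
  set I : Ideal O := Ideal.span (Set.range x) with hI
  -- the quotient of the base by the boundary equations
  obtain ⟨hregO, hdimO⟩ := RegularParameters.isRegularLocalRing_quotient_span_range x hx hli
  haveI := hregO
  have hItop : I ≠ ⊤ := by
    refine fun h => (maximalIdeal.isMaximal O).ne_top (top_le_iff.mp (h ▸ ?_))
    exact Ideal.span_le.mpr (by rintro _ ⟨j, rfl⟩; exact hx j)
  haveI : CharP (O ⧸ I) p := charP_quotient_of_ne_top p I hItop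
  have hū := RegularParameters.isWoundOrTransversalAt_quotient (p := p) hx hu
  -- `C/(x)C ≅ (𝒪/(x))[T]/(T^p - ū)`
  have hmap : f.map (Ideal.Quotient.mk I) = X ^ p - C (Ideal.Quotient.mk I u) := by
    rw [hf, Polynomial.map_sub, Polynomial.map_pow, map_X, map_C]
  let e : (AdjoinRoot f ⧸ I.map (AdjoinRoot.of f)) ≃+*
      AdjoinRoot ((X : (O ⧸ I)[X]) ^ p - C (Ideal.Quotient.mk I u)) :=
    (AdjoinRoot.quotEquivQuotMap f I).toRingEquiv.trans
      (AdjoinRoot.algEquivOfEq (O ⧸ I) _ _ hmap).toRingEquiv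
  have hregC := isRegularLocalRing_woundTwist p (Fin.elim0 : Fin 0 → O ⧸ I) _ hū
  refine ⟨IsRegularLocalRing.of_ringEquiv e.symm, ?_⟩
  rw [ringKrullDim_eq_of_ringEquiv e, ringKrullDim_woundTwist p hp.pos,
    ringKrullDim_woundTwist p hp.pos, hdimO]

end Summit.ResolutionOfSingularities.ResolutionOfSingularities.Theorems.PicoverLocalModel.LocalCharts

end
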